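import Summits.BirchSwinnertonDyer.BirchSwinnertonDyer.Theorems.KolyvaginRoadThreeSchneiderTamAtThreeHeightLogNumeratorSeries
import HarnessLib

/-!
# «The height is the logarithm of the numerator» at a prime `p ≥ 5`, part A: second-order estimates

HONEST FRAMING (cell `bsd-stepL`, seat `bsd-stepL-tam3-p2` g0; `--supports stmt-BirchSwinnertonDyer-19154 --as helper`):
THEOREMS ONLY, unconditional, route-independent (no Theses import); 0 definitions, 0 named facts, 0 sorry;
nothing here proves the crux `SchneiderTamAtThree` (a `p = 3` statement; parts 1–4 of this series treat
`p = 3`), Schneider's conjecture or BSD. This is the `p ≥ 5` companion — the same closed form at every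
prime `p ≥ 5` of multiplicative reduction, where NO scale congruence is needed (`⅓`, `1/12` are
`p`-integral); consumer-in-waiting: the `p ≥ 5` REG-MULT ∕ REST universes of lane A (`bsd-stepL-reg3-eng`
v2 ∕ v3: 22 480 pairs, two kernel rungs), i.e. Schneider's binder `RegulatorNonvanishingAt W p` of the
lever at `p ≥ 5` (route ErratumRoadFive rows 19702 ∕ 19703).

* `norm_coeff_formalLog_le_norm_inv_padic` — `‖coeff (n+2) log_W‖_p ≤ ‖1/(n+2)‖_p` (any `p`);
* `norm_padicFormalLog_sub_cubic_le_pow_four_padic` — `‖log_W z − (z + ½a₁z² + ⅓(a₁²+a₂)z³)‖_p ≤ ‖z‖⁴`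
  on `‖z‖_p ≤ p⁻¹`, `p ≥ 5` (`v_p(n+4) ≤ n`);
* `norm_coshOfSq_sub_quadratic_le_padic`, `norm_two_mul_coshOfSq_sub_one_sub_sub_le_padic` —
  `‖2(ch w − 1) − w − w²/12‖_p ≤ p²‖w‖³` on `‖w‖_p ≤ p⁻²`, `p` odd;
* `norm_pow_three_div_sq_sub_le_padic` — `‖x³/y² − 1 − a₁x/y‖_p ≤ ‖x‖_p⁻¹` on `E₁` (any `p`).

References: [SilvermanAEC2009] IV.1, IV.5–6, VII.2; [SteinWuthrich2013] §4.2; ui-o2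
`Uniform/UI/O2SigmaValuationLemmas.lean` (`norm_coshOfSq_term`, `padicValNat_factorial_two_mul_add_two_le`),
lane A `ClassRecordThreeRung62310y1HeightEvalFormalLog.lean` (coefficients of `log_W`), part 1 of the
`p = 3` series (`norm_tprod_tateSigmaSq_factor_sub_one_le_mul`, any `p`).
-/

noncomputable section

open scoped Classical Nat
open Filter Topology IsUltrametricDist PowerSeries
open WeierstrassCurve Literature.NumberTheory.EllipticCurves
open Literature.NumberTheory.EllipticCurves.SteinWuthrich2013
open Literature.NumberTheory.EllipticCurves.TateCurve
open Literature.NumberTheory.EllipticCurves.Rank1Residual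
open Summit.BirchSwinnertonDyer.Uniform.UI.O2

namespace Summit.BirchSwinnertonDyer.Rank1Residual.X11b.RegMult.HeightLogNumerator

variable {p : ℕ} [hp : Fact p.Prime]

/-! ### §1′ The formal logarithm to third order at a prime `p ≥ 5`: error `‖z‖⁴` on `‖z‖ ≤ p⁻¹` -/

section FormalLog

variable (V : WeierstrassCurve ℚ_[p]) [V.IsIntegral ℤ_[p]]

/-- `‖coeff (n+2) log_W‖_p ≤ ‖1/(n+2)‖_p` for a `p`-integral equation (`ω ∈ ℤ_p⟦z⟧`; general-`p` form of
lane A's `Rung62310y1.norm_coeff_formalLog_le_norm_inv`). [cite: SilvermanAEC2009, IV.5.5, IV.6.3] -/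
theorem norm_coeff_formalLog_le_norm_inv_padic (n : ℕ) :
    ‖coeff (n + 2) V.formalLog‖ ≤ ‖(((n + 2 : ℕ) : ℚ_[p]))⁻¹‖ := by
  rw [WeierstrassCurve.formalLog, coeff_mk]
  dsimp only
  rw [norm_mul, map_div₀, map_one, one_div]
  have h1 : (algebraMap ℚ ℚ_[p] (n + 2 : ℚ)) = ((n + 2 : ℕ) : ℚ_[p]) := by
    rw [map_add, map_natCast, map_ofNat]; push_cast; ring
  rw [h1]
  have h2 : ‖coeff (n + 1) V.formalOmega‖ ≤ 1 := isPadicInt_iff_coeff.mp V.isPadicInt_formalOmega _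
  calc ‖(((n + 2 : ℕ) : ℚ_[p]))⁻¹‖ * ‖coeff (n + 1) V.formalOmega‖
      ≤ ‖(((n + 2 : ℕ) : ℚ_[p]))⁻¹‖ * 1 := by gcongr
    _ = _ := mul_one _

omit hp in
/-- `5^{n+1} > n + 4`. [folklore] -/
private theorem five_pow_succ_gt (n : ℕ) : n + 4 < 5 ^ (n + 1) := by
  induction n with
  | zero => norm_num
  | succ k ih => rw [pow_succ]; omega

/-- `v_p(n + 4) ≤ n` for `p ≥ 5` (`p^{v} ∣ n + 4` forces `p^v ≤ n + 4 < 5^{n+1} ≤ p^{n+1}`). [folklore] -/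
private theorem padicValNat_add_four_le (hp5 : 5 ≤ p) (n : ℕ) : padicValNat p (n + 4) ≤ n := by
  have hdvd : p ^ padicValNat p (n + 4) ∣ n + 4 := pow_padicValNat_dvd
  have hle : p ^ padicValNat p (n + 4) ≤ n + 4 := Nat.le_of_dvd (by omega) hdvd
  by_contra hgt
  have hge : n + 1 ≤ padicValNat p (n + 4) := by omega
  have h1 : 5 ^ (n + 1) ≤ p ^ (n + 1) := Nat.pow_le_pow_left hp5 _
  have h2 : p ^ (n + 1) ≤ p ^ padicValNat p (n + 4) := Nat.pow_le_pow_right hp.out.pos hge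
  have := five_pow_succ_gt n
  omega

/-- `‖1/(n+4)‖_p ≤ pⁿ` for `p ≥ 5`. [folklore] -/
private theorem norm_inv_natCast_add_four_le_padic (hp5 : 5 ≤ p) (n : ℕ) :
    ‖(((n + 4 : ℕ) : ℚ_[p]))⁻¹‖ ≤ (p : ℝ) ^ n := by
  have hp1 : (1 : ℝ) ≤ p := by exact_mod_cast hp.out.one_lt.le
  rw [norm_inv, Padic.norm_eq_zpow_neg_valuation (by exact_mod_cast (show (n + 4 : ℕ) ≠ 0 by omega)),
    Padic.valuation_natCast, zpow_neg, inv_inv, zpow_natCast]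
  exact pow_le_pow_right₀ hp1 (padicValNat_add_four_le hp5 n)

/-- The terms of degree `n + 4` of `log_W(z)` have norm `≤ ‖z‖⁴` when `‖z‖_p ≤ p⁻¹`, `p ≥ 5`.
[cite: SilvermanAEC2009, IV.6.3] -/
private theorem norm_formalLog_term_le_pow_four_padic (hp5 : 5 ≤ p) {z : ℚ_[p]} (hz : ‖z‖ ≤ (p : ℝ)⁻¹)
    (n : ℕ) : ‖coeff (n + 4) V.formalLog * z ^ (n + 4)‖ ≤ ‖z‖ ^ 4 := by
  have hp0 : (0 : ℝ) < p := by exact_mod_cast hp.out.pos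
  rw [norm_mul, norm_pow]
  have hc := norm_coeff_formalLog_le_norm_inv_padic V (n + 2)
  rw [show n + 2 + 2 = n + 4 by ring] at hc
  have hz0 : 0 ≤ ‖z‖ := norm_nonneg z
  calc ‖coeff (n + 4) V.formalLog‖ * ‖z‖ ^ (n + 4) ≤ (p : ℝ) ^ n * ‖z‖ ^ (n + 4) := by
        gcongr; exact hc.trans (norm_inv_natCast_add_four_le_padic hp5 n)
    _ = ((p : ℝ) ^ n * ‖z‖ ^ n) * ‖z‖ ^ 4 := by ring
    _ ≤ ((p : ℝ) ^ n * ((p : ℝ)⁻¹) ^ n) * ‖z‖ ^ 4 := by gcongr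
    _ = ‖z‖ ^ 4 := by rw [← mul_pow, mul_inv_cancel₀ hp0.ne', one_pow, one_mul]

/-- **`log_W(z) = z + (a₁/2)z² + ((a₁²+a₂)/3)z³ + O(‖z‖⁴)` on `‖z‖_p ≤ p⁻¹`, `p ≥ 5`.**
[cite: SilvermanAEC2009, IV.5.5, IV.6.4] -/
theorem norm_padicFormalLog_sub_cubic_le_pow_four_padic (hp5 : 5 ≤ p) {z : ℚ_[p]}
    (hz : ‖z‖ ≤ (p : ℝ)⁻¹) :
    ‖V.padicFormalLog z - (z + (2 : ℚ_[p])⁻¹ * V.a₁ * z ^ 2 + (3 : ℚ_[p])⁻¹ * (V.a₁ ^ 2 + V.a₂) * z ^ 3)‖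
      ≤ ‖z‖ ^ 4 := by
  have hp1 : (1 : ℝ) < p := by exact_mod_cast hp.out.one_lt
  have hs := V.summable_formalLog_of_isIntegral z (hz.trans_lt (inv_lt_one_of_one_lt₀ hp1))
  have hsplit := hs.sum_add_tsum_nat_add 4
  have h0 : coeff 0 V.formalLog = 0 := by rw [coeff_zero_eq_constantCoeff]; exact V.constantCoeff_formalLog
  have h2 : coeff 2 V.formalLog = (2 : ℚ_[p])⁻¹ * V.a₁ := by
    rw [(Rung62310y1.coeff_two_formalLog V), eq_ratCast]; push_cast; ring
  have h3 : coeff 3 V.formalLog = (3 : ℚ_[p])⁻¹ * (V.a₁ ^ 2 + V.a₂) := by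
    rw [(Rung62310y1.coeff_three_formalLog V), eq_ratCast]; push_cast; ring
  have hfour : ∑ i ∈ Finset.range 4, coeff i V.formalLog * z ^ i =
      z + (2 : ℚ_[p])⁻¹ * V.a₁ * z ^ 2 + (3 : ℚ_[p])⁻¹ * (V.a₁ ^ 2 + V.a₂) * z ^ 3 := by
    simp only [Finset.sum_range_succ, Finset.sum_range_zero, h0, V.coeff_one_formalLog, h2, h3]
    ring
  rw [WeierstrassCurve.padicFormalLog, ← hsplit, hfour, add_sub_cancel_left]
  exact IsUltrametricDist.norm_tsum_le_of_forall_le_of_nonneg (by positivity) fun n ↦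
    norm_formalLog_term_le_pow_four_padic V hp5 hz n

end FormalLog

/-! ### §2′ The `cosh` series to second order at an odd prime: `‖2(ch w − 1) − w − w²/12‖ ≤ p²‖w‖³` on `‖w‖ ≤ p⁻²` -/

/-- **`‖ch(w) − (1 + w/2 + w²/24)‖_p ≤ p²‖w‖³` for `‖w‖_p ≤ p⁻²`, `p` odd**: each term `wⁿ/(2n)!`, `n ≥ 3`,
has norm `‖w‖ⁿ p^{v_p((2n)!)} ≤ ‖w‖ⁿ pⁿ⁻¹ ≤ p²‖w‖³`. [folklore] -/
theorem norm_coshOfSq_sub_quadratic_le_padic (hp2 : p ≠ 2) {w : ℚ_[p]} (hw : ‖w‖ ≤ ((p : ℝ)⁻¹) ^ 2) :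
    ‖coshOfSq w - (1 + w / 2 + w ^ 2 / 24)‖ ≤ (p : ℝ) ^ 2 * ‖w‖ ^ 3 := by
  have hp1 : (1 : ℝ) < p := by exact_mod_cast hp.out.one_lt
  have hp1' : (1 : ℝ) ≤ p := hp1.le
  have hp0 : (0 : ℝ) < p := by positivity
  set t : ℕ → ℚ_[p] := fun n => w ^ n / ((2 * n) ! : ℚ_[p]) with ht
  have hsum : Summable t := by
    refine Summable.of_norm_bounded
      (summable_geometric_of_lt_one (by positivity) (inv_lt_one_of_one_lt₀ hp1)) fun n => ?_
    exact norm_coshOfSq_term_le hp2 hw n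
  have h0 : coshOfSq w = ∑' n, t n := rfl
  have hsplit := hsum.sum_add_tsum_nat_add 3
  have hthree : ∑ i ∈ Finset.range 3, t i = 1 + w / 2 + w ^ 2 / 24 := by
    simp only [Finset.sum_range_succ, Finset.sum_range_zero, ht]
    norm_num [Nat.factorial]
  rw [h0, ← hsplit, hthree, add_sub_cancel_left]
  refine IsUltrametricDist.norm_tsum_le_of_forall_le_of_nonneg (by positivity) fun n ↦ ?_
  have hw0 : 0 ≤ ‖w‖ := norm_nonneg w
  rw [ht]
  dsimp only
  rw [norm_coshOfSq_term]
  have hv : (padicValNat p (2 * (n + 3))! : ℤ) ≤ ((n + 2 : ℕ) : ℤ) := by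
    have := padicValNat_factorial_two_mul_add_two_le hp2 (n + 1)
    rw [show n + 1 + 2 = n + 3 by ring] at this
    exact_mod_cast this
  calc ‖w‖ ^ (n + 3) * (p : ℝ) ^ (padicValNat p (2 * (n + 3))! : ℤ)
      ≤ ‖w‖ ^ (n + 3) * (p : ℝ) ^ ((n + 2 : ℕ) : ℤ) :=
        mul_le_mul_of_nonneg_left (zpow_le_zpow_right₀ hp1' hv) (pow_nonneg hw0 _)
    _ = ((p : ℝ) ^ 2 * ‖w‖ ^ 3) * (‖w‖ * p) ^ n := by rw [zpow_natCast]; ring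
    _ ≤ ((p : ℝ) ^ 2 * ‖w‖ ^ 3) * 1 := by
        refine mul_le_mul_of_nonneg_left ?_ (by positivity)
        refine pow_le_one₀ (by positivity) ?_
        calc ‖w‖ * p ≤ ((p : ℝ)⁻¹) ^ 2 * p := mul_le_mul_of_nonneg_right hw hp0.le
          _ = (p : ℝ)⁻¹ := by field_simp
          _ ≤ 1 := inv_le_one_of_one_le₀ hp1'
    _ = (p : ℝ) ^ 2 * ‖w‖ ^ 3 := mul_one _

/-- **`‖2(ch(w) − 1) − w − w²/12‖_p ≤ p²‖w‖³` for `‖w‖_p ≤ p⁻²`, `p` odd** (`‖2‖_p = 1`). [folklore] -/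
theorem norm_two_mul_coshOfSq_sub_one_sub_sub_le_padic (hp2 : p ≠ 2) {w : ℚ_[p]}
    (hw : ‖w‖ ≤ ((p : ℝ)⁻¹) ^ 2) :
    ‖2 * (coshOfSq w - 1) - w - w ^ 2 / 12‖ ≤ (p : ℝ) ^ 2 * ‖w‖ ^ 3 := by
  have h2 : ‖(2 : ℚ_[p])‖ = 1 := by
    simpa using Padic.norm_natCast_eq_one_iff.mpr ((Nat.coprime_primes hp.out Nat.prime_two).mpr hp2)
  have e : 2 * (coshOfSq w - 1) - w - w ^ 2 / 12 = 2 * (coshOfSq w - (1 + w / 2 + w ^ 2 / 24)) := by ring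
  rw [e, norm_mul, h2, one_mul]
  exact norm_coshOfSq_sub_quadratic_le_padic hp2 hw

/-! ### §3′ The equation to second order at any prime -/

/-- **`‖x³/y² − 1 − a₁·x/y‖_p ≤ ‖x‖_p⁻¹`** for a point `(x, y)` with `‖x‖_p > 1` of a `p`-integral equation
(any prime `p`; the `p = 3` copy is `norm_pow_three_div_sq_sub_le`). [cite: SilvermanAEC2009, IV.1 and VII.2.2] -/
theorem norm_pow_three_div_sq_sub_le_padic {V : WeierstrassCurve ℚ_[p]} [V.IsIntegral ℤ_[p]] {x y : ℚ_[p]}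
    (heq : V.toAffine.Equation x y) (hx : 1 < ‖x‖) :
    ‖x ^ 3 / y ^ 2 - 1 - V.a₁ * (x / y)‖ ≤ ‖x‖⁻¹ := by
  obtain ⟨h₁, h₂, h₃, h₄, h₆⟩ := V.norm_coeffs_le_one
  obtain ⟨hsq, hxy⟩ := V.norm_sq_eq_norm_cube heq hx
  rw [Affine.equation_iff] at heq
  have hx0 : 0 < ‖x‖ := one_pos.trans hx
  have hy1 : 1 < ‖y‖ := hx.trans hxy
  have hy0 : 0 < ‖y‖ := one_pos.trans hy1
  have hy0' : y ≠ 0 := norm_pos_iff.mp hy0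
  have hy2 : y ^ 2 ≠ 0 := pow_ne_zero 2 hy0'
  have hnum : x ^ 3 - y ^ 2 - V.a₁ * x * y = V.a₃ * y + (-(V.a₂ * x ^ 2) + (-(V.a₄ * x) + -V.a₆)) := by
    linear_combination -heq
  have e : x ^ 3 / y ^ 2 - 1 - V.a₁ * (x / y) =
      (V.a₃ * y + (-(V.a₂ * x ^ 2) + (-(V.a₄ * x) + -V.a₆))) / y ^ 2 := by
    rw [← hnum, eq_div_iff hy2]
    field_simp
  rw [e, norm_div, norm_pow, div_le_iff₀ (pow_pos hy0 2)]
  have hrhs : ‖x‖⁻¹ * ‖y‖ ^ 2 = ‖x‖ ^ 2 := by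
    rw [hsq, pow_succ', ← mul_assoc, inv_mul_cancel₀ hx0.ne', one_mul]
  rw [hrhs]
  have hx1 : 1 ≤ ‖x‖ := hx.le
  have hxx : ‖x‖ ≤ ‖x‖ ^ 2 := by nlinarith
  have hyx2 : ‖y‖ ≤ ‖x‖ ^ 2 := by nlinarith [hsq, norm_nonneg y]
  refine (norm_add_le_max _ _).trans (max_le ?_ ((norm_add_le_max _ _).trans (max_le ?_
    ((norm_add_le_max _ _).trans (max_le ?_ ?_)))))
  · rw [norm_mul]
    calc ‖V.a₃‖ * ‖y‖ ≤ 1 * ‖y‖ := by gcongr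
      _ = ‖y‖ := one_mul _
      _ ≤ ‖x‖ ^ 2 := hyx2
  · rw [norm_neg, norm_mul, norm_pow]
    calc ‖V.a₂‖ * ‖x‖ ^ 2 ≤ 1 * ‖x‖ ^ 2 := by gcongr
      _ = ‖x‖ ^ 2 := one_mul _
  · rw [norm_neg, norm_mul]
    calc ‖V.a₄‖ * ‖x‖ ≤ 1 * ‖x‖ := by gcongr
      _ = ‖x‖ := one_mul _
      _ ≤ ‖x‖ ^ 2 := hxx
  · rw [norm_neg]
    calc ‖V.a₆‖ ≤ 1 := h₆
      _ ≤ ‖x‖ := hx1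
      _ ≤ ‖x‖ ^ 2 := hxx



end Summit.BirchSwinnertonDyer.Rank1Residual.X11b.RegMult.HeightLogNumerator

end
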